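import Literature.MathematicalPhysics.QuantumFieldTheory.Balaban1983to89.B9Thm31GpAgmonDecayCoarseZd
import Literature.MathematicalPhysics.QuantumFieldTheory.Balaban1983to89.B9Thm31LevelPoincareCoerciveZd

/-!
# `Balaban1983to89.B9Thm31GpAgmonDecayFlatCubeZd` — [Balaban1984PropagatorsII] Thm (2.22)∕p. 226 with [Balaban1985BackgroundPropagators] Thm 3.1 (3.42) p. 397 AT `U₀ = 1`:
# ★★★ THE MULTI-LEVEL FLAT GREEN OPERATOR `G′(1) = (□₀Δ′_a(1)□₀)⁻¹` OF EVERY CUBE MEMBER OF (1.131) DECAYS WITH MEMBER-UNIFORM EXPLICIT CONSTANTS —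
# for weights with print's scaling `a_lo(Lᵈ)ʲ(ηLʲ)⁻² ≤ a_j ≤ a_hi(Lᵈ)ʲ(ηLʲ)⁻²` (`j ≤ m`), with `m₈ := min{8, a_lo}` and
# `κ₀ := min{1, m₈∕(12d + 30a_hi)}`, for every `0 ≤ κ ≤ κ₀` and all `x, y ∈ □₀`:
# `|(G′(1)δ_y w)(x)|_τ ≤ (2∕m₈)·(ηLᵐ)²·e^{−κL^{−m}|x−y|_∞}·|w|_τ` — NO `η`, NO `|□₀|`, NO displayed hypothesis (unconditional at the flat background)

statement-level skeleton of published theorems with citation tags; proofs where landed; nothing here is a claim about the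
Yang–Mills mass gap

`[Balaban1985BackgroundPropagators]` ("B9", CMP **99** (1985) 389–434) Thm 3.1 p. 397 *«|(G′(U)f)(x)| ≤ O(1)(Lʲη)²e^{−δ₀d(y,y′)}|f| (3.42) … uniformly in U, Ω_j»*; at `U = 1`
this is [Balaban1984PropagatorsII] ("[4]", CMP **96** (1984) 223–250) §2 (the averaged propagators on the sequence of domains).  Print: random walk (Sect. B).  THIS FILE is
the UNCONDITIONAL end of this seat's Agmon road at the `ℤᵈ` junction frame for the FLAT background: FILE 5 `B9Thm31LevelPoincareCoerciveZd` (the level-weighted flat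
coercivity with masses `min{8(ηLʲ)⁻², a_j(Lᵈ)^{−j}}` per block, from dag-n06-w4 g5's block inequality) discharges the displayed `hco` of FILE 4
`B9Thm31GpAgmonDecayCoarseZd`, and print's SCALING of the weights (two-sided, `a_lo ≤ a_j(ηLʲ)²(Lᵈ)^{−j} ≤ a_hi`) discharges its two scaling slots with `B = 1∕m₈`,
`A = a_hi∕m₈` (`m₈ = min{8, a_lo}`).  WHAT IS UNIFORM: every constant — `κ₀ = min{1, m₈∕(12d + 30a_hi)}` (θ = 1∕2), the amplitude `(2∕m₈)(ηLᵐ)²` — depends on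
`d, a_lo, a_hi` ONLY; NOT on `η`, `k`, `m`, `L`, `M_c`, `ρ`, the member or its volume.  WHAT IS NOT: the curved class (3.35) (dag-n06-w4's near-flat road supplies the
coercivity there; FILE 4's displayed `hco` then gives the same conclusion), print's finer multi-scale rate on the inner shells, the sup-norm∕Hölder entries.

CITATION HEADER (lean-in-tree rule).  Cell `pub-ymgap` (YM Track A, HUMAN RULING D-0062 ∕ D-0149 width push), DAG node N06 = [B9], width seat
`pub-ymgap-dag-n06-w2` (g5), CLAIM-6.  Inputs BY NAME: FILE 4's `fnorm_GpZd_single_le_exp_coarse`, FILE 5's `sum_mass_le_formE_deltaPrimeADom_one_cubeMember`, dag-n06-w4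
g5's `fullBlockGeometry_cubeMember ∕ cover_cubeLamS`, `B8Eq119TwistedAxial.bgT_one`.  Nothing restated.

WHAT IS PROVED (kernel, 0 sorry, 0 def; no `instance`, no `notation`).
* §1 `sum_ite_eq_of_fullBlockGeometry` (under `FullBlockGeometry`, a site under the constraint point `(j₀, y₀)` sees no other: `Σ_{j≤m}𝟙[yʲ(z)∈Λ_j]g_j = g_{j₀}`) — the
  site mass used below is `M(z) := Σ_{j≤m}𝟙[yʲ(z)∈Λ_j]·m₈((ηLʲ)²)⁻¹` (one term per site of `□₀`).
* §2 ★★★ `fnorm_GpZd_one_single_le_exp_cubeMember` — THE UNCONDITIONAL FLAT BOUND at a cube member (`L ≤ ρ`, `2 ≤ L`, `m ≤ i.k`, tracial Hermitian faithful `τ`,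
  finite-dimensional nontrivial `𝔸`): print-scaled weights ⟹ for `0 ≤ κ ≤ 1` with `κ(12d + 30a_hi) ≤ m₈` and `x, y ∈ □₀`:
  `|(G′(1)δ_y w)(x)|_τ ≤ (2∕m₈)·(ηLᵐ)²·e^{−κL^{−m}|x−y|_∞}·|w|_τ`.
* §3 ★★ `fnorm_GpZd_one_single_le_exp_cubeMember_printWeights` — A6 with print's own weights `a_j = (Lᵈ)ʲ(ηLʲ)⁻²` (`a_lo = a_hi = 1`, `m₈ = 1`):
  `|(G′(1)δ_y w)(x)|_τ ≤ 2(ηLᵐ)²·e^{−(12d+30)⁻¹L^{−m}|x−y|_∞}·|w|_τ` on `□₀` — no hypothesis beyond the cube member.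

HONEST SCOPE.  Flat background; single (coarsest) scale rate; `L²`-derived pointwise bound (not print's sup-norm block bound); the two-sided scaling of `a_j` is a
HYPOTHESIS on the member's data (print's recursive `a_j` satisfy it).  Count-neutral; N05 ∕ N06 NOT discharged; K1⁹ `stmt-QuantumFields-27364` NOT closed; one finite `𝕋⁴`
programme at fixed `ε`, Bałaban as printed; R4 closes only the conditional finite-`𝕋⁴` rung `BalabanLadder.UV` — nothing continuum ∕ ℝ⁴ ∕ OS ∕ mass gap ∕ Clay.
Unit `pub-ymgap-dag-n06-w2` (g5), 2026-08-28.
-/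

noncomputable section

open scoped BigOperators

namespace Literature.MathematicalPhysics.QuantumFieldTheory.Balaban1983to89.B9Thm31GpAgmonDecayFlatCubeZd

open B7Prop1Explicit (e)
open B7Prop2Explicit (unitaryUnits)
open B8Eq119TwistedAxial (bgT bgT_one)
open B8Eq131CubesAdmissible (cubeFam)
open B8CubeMemberZd (cubeLamS)
open B8LeafModelZd (ZdIdx)
open B8Eq191FlatLettersCubeMember (cubeLamS_finite)
open B9Thm311PosDefOpenZd (cubeMember_Ω0_finite)
open B9Eq319QQStarDiagonalZd (FullBlockGeometry fullBlockGeometry_cubeMember)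
open B9Eq321LandauProjectionZd (suppSub formE formE_apply)
open B9Eq324DeltaPrimeAZd (single restrictSite deltaPrimeADom GpZd)
open B9Eq325QprimeSingleSiteZd (blockMapIter)
open B9Eq342CombesThomasFormZd
open B9Thm31FlatPoincareCoerciveZd (cover_cubeLamS)
open B9Thm31GpAgmonDecayCoarseZd (fnorm_GpZd_single_le_exp_coarse)
open B9Thm31LevelPoincareCoerciveZd (sum_mass_le_formE_deltaPrimeADom_one_cubeMember)
open LatticeNorms (linfDist)

export B7Prop1Explicit (Site)

variable {d : ℕ} {𝔸 : Type*} [CStarAlgebra 𝔸]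

/-! ## §1  A site under one constraint point sees no other (`FullBlockGeometry`) -/

section Geometry

omit [CStarAlgebra 𝔸] in
/-- **UNDER `FullBlockGeometry`, THE INDICATOR SUM HAS ONE TERM**: if `blockMap^[j₀] z = y₀ ∈ Λ_{j₀}` (`j₀ ≤ m`) then `Σ_{j≤m}𝟙[yʲ(z)∈Λ_j]·g_j = g_{j₀}`.
[cite: Balaban1985BackgroundPropagators, (3.18) p.393 («Λ_j = Ω_j^{(j)} ∖ Ω_{j+1}^{(j)}»: the blocks of distinct constraint points are disjoint)] -/
theorem sum_ite_eq_of_fullBlockGeometry {L m : ℕ} {Λ : ℕ → Finset (Site d)} {s : Finset (Site d)} (hG : FullBlockGeometry L m Λ s)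
    {j₀ : ℕ} (hj₀ : j₀ ∈ Finset.range (m + 1)) {z : Site d} (hz : blockMapIter L j₀ z ∈ Λ j₀) (g : ℕ → ℝ) :
    ∑ j ∈ Finset.range (m + 1), (if blockMapIter L j z ∈ Λ j then g j else 0) = g j₀ := by
  rw [Finset.sum_eq_single_of_mem j₀ hj₀ fun j hj hne => ?_]
  · rw [if_pos hz]
  · by_cases h : blockMapIter L j z ∈ Λ j
    · exfalso
      have hne' : (j, blockMapIter L j z) ≠ (j₀, blockMapIter L j₀ z) := fun h' => hne (Prod.ext_iff.1 h').1
      exact (hG j₀ hj₀ _ hz).2 j hj _ h hne' z rfl rfl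
    · rw [if_neg h]

end Geometry

/-! ## §2  ★★★ The unconditional flat bound at a cube member -/

section Flat

variable (L : ℕ) (τ : 𝔸 →ₗ[ℂ] ℂ) [FiniteDimensional ℝ 𝔸] (hτp : ∀ a : 𝔸, a ≠ 0 → 0 < (τ (star a * a)).re)

/-- ★★★ **[B6]∕[B9] THM 3.1's (3.42), n = 0 SHAPE, FOR THE FLAT MULTI-LEVEL `G′(1)` OF EVERY CUBE MEMBER OF (1.131), WITH MEMBER-UNIFORM EXPLICIT CONSTANTS.**
`2 ≤ L ≤ ρ`, `m ≤ i.k`; `τ` tracial Hermitian faithful, `𝔸` finite-dimensional nontrivial; weights with print's scaling `a_lo·(Lᵈ)ʲ·((ηLʲ)²)⁻¹ ≤ a_j ≤ a_hi·(Lᵈ)ʲ·((ηLʲ)²)⁻¹`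
for `j ≤ m` (`0 < a_lo`), all `a_j ≥ 0`; `m₈ := min{8, a_lo}`; `0 ≤ κ ≤ 1` with `κ·(12d + 30a_hi) ≤ m₈`.  THEN for all `x, y ∈ □₀`:
`|(G′(1)δ_y w)(x)|_τ ≤ (2∕m₈)·(ηLᵐ)²·e^{−κL^{−m}|x−y|_∞}·|w|_τ` — constants depending on `d, a_lo, a_hi` only.
[cite: Balaban1985BackgroundPropagators, Thm 3.1 p.397, (3.42) p.397, (3.24) p.394, Thm 3.11 p.416; Balaban1984PropagatorsII, (2.22) p.226; Balaban1985RegularSpaces, (1.131) p.99; Agmon1982, Thm 1.5 p.19] -/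
theorem fnorm_GpZd_one_single_le_exp_cubeMember [Nontrivial 𝔸] (hd : 0 < d) (hL : 2 ≤ L) (hτt : ∀ a b : 𝔸, τ (a * b) = τ (b * a))
    (hτs : ∀ a : 𝔸, τ (star a) = starRingEnd ℂ (τ a)) (i : ZdIdx d L) {ac : Site d} {Mc ρc : ℕ} (hΩ : i.Ω = cubeFam false L ac Mc ρc i.k)
    (hρc : L ≤ ρc) {m : ℕ} (hm : m ≤ i.k) {a : ℕ → ℝ} (ha : ∀ j, 0 ≤ a j) {a_lo a_hi : ℝ} (halo : 0 < a_lo)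
    (hlo : ∀ j ∈ Finset.range (m + 1), a_lo * ((L : ℝ) ^ d) ^ j * ((i.η * (L : ℝ) ^ j) ^ 2)⁻¹ ≤ a j)
    (hhi : ∀ j ∈ Finset.range (m + 1), a j ≤ a_hi * ((L : ℝ) ^ d) ^ j * ((i.η * (L : ℝ) ^ j) ^ 2)⁻¹)
    {κ : ℝ} (hκ0 : 0 ≤ κ) (hκ1 : κ ≤ 1) (hκ : κ * (12 * d + 30 * a_hi) ≤ min 8 a_lo)
    {x y : Site d} (hx : x ∈ (cubeMember_Ω0_finite i hΩ).toFinset) (hy : y ∈ (cubeMember_Ω0_finite i hΩ).toFinset) (w : 𝔸) :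
    fnorm τ ((GpZd L (1 : Site d → Fin d → 𝔸ˣ) i.η τ hτp m a (fun j => (cubeLamS_finite L ac Mc ρc i.k m j).toFinset)
        (cubeMember_Ω0_finite i hΩ).toFinset hd i.hη.ne' hτt hτs (fun _ _ => (unitaryUnits 𝔸).one_mem) ha
        (restrictSite (cubeMember_Ω0_finite i hΩ).toFinset (single y w)) : Site d → 𝔸) x) ≤
      2 / min 8 a_lo * (i.η * (L : ℝ) ^ m) ^ 2 * Real.exp (-(κ * (((L : ℝ) ^ m)⁻¹ * ((linfDist x y : ℕ) : ℝ)))) * fnorm τ w := by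
  classical
  haveI : NeZero L := ⟨by omega⟩
  have hL1 : 1 ≤ L := le_trans one_le_two hL
  have hL0 : (0 : ℝ) < L := by exact_mod_cast (lt_of_lt_of_le zero_lt_two hL)
  set S := (cubeMember_Ω0_finite i hΩ).toFinset with hS
  set Λ : ℕ → Finset (Site d) := fun j => (cubeLamS_finite L ac Mc ρc i.k m j).toFinset with hΛ
  set η : ℝ := i.η with hη
  have hη0 : 0 < η := i.hη
  set m₈ : ℝ := min 8 a_lo with hm₈
  have hm₈0 : 0 < m₈ := lt_min (by norm_num) halo
  have hm₈8 : m₈ ≤ 8 := min_le_left _ _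
  have hm₈lo : m₈ ≤ a_lo := min_le_right _ _
  have hahi0 : 0 ≤ a_hi := by
    have h0 := hlo 0 (Finset.mem_range.2 (Nat.succ_pos m))
    have h1 := hhi 0 (Finset.mem_range.2 (Nat.succ_pos m))
    have hpos : 0 < ((L : ℝ) ^ d) ^ 0 * ((η * (L : ℝ) ^ 0) ^ 2)⁻¹ := by positivity
    have : a_lo * ((L : ℝ) ^ d) ^ 0 * ((η * (L : ℝ) ^ 0) ^ 2)⁻¹ ≤ a_hi * ((L : ℝ) ^ d) ^ 0 * ((η * (L : ℝ) ^ 0) ^ 2)⁻¹ := h0.trans h1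
    rw [mul_assoc, mul_assoc] at this
    nlinarith [le_of_mul_le_mul_right this hpos]
  -- geometry of the member
  have hG : FullBlockGeometry L m Λ S := fullBlockGeometry_cubeMember i hΩ hρc hm
  have hsS : ∀ z, z ∈ S ↔ z ∈ cubeFam false L ac Mc ρc i.k 0 := fun z => by rw [hS, Set.Finite.mem_toFinset, hΩ]
  have hΛmem : ∀ j y', y' ∈ Λ j ↔ y' ∈ cubeLamS L ac Mc ρc i.k m j := fun j y' => Set.Finite.mem_toFinset _
  have hcov : ∀ z ∈ S, ∃ j ∈ Finset.range (m + 1), blockMapIter L j z ∈ Λ j := by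
    intro z hz
    obtain ⟨j, hj, hmem⟩ := cover_cubeLamS hL1 ac Mc ρc ((hsS z).1 hz) (m := m)
    exact ⟨j, hj, (hΛmem j _).2 hmem⟩
  -- the site mass: `m₈(ηL^{j(z)})⁻²` at the level owning `z`
  set M : Site d → ℝ := fun z => ∑ j ∈ Finset.range (m + 1), (if blockMapIter L j z ∈ Λ j then m₈ * ((η * (L : ℝ) ^ j) ^ 2)⁻¹ else 0) with hM
  have hMval : ∀ j₀ ∈ Finset.range (m + 1), ∀ z : Site d, blockMapIter L j₀ z ∈ Λ j₀ → M z = m₈ * ((η * (L : ℝ) ^ j₀) ^ 2)⁻¹ :=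
    fun j₀ hj₀ z hz => sum_ite_eq_of_fullBlockGeometry hG hj₀ hz _
  have hM0 : ∀ z ∈ S, 0 ≤ M z := fun z _ =>
    Finset.sum_nonneg fun j _ => by split_ifs <;> positivity
  -- the level-weighted flat coercivity (FILE 5) with this mass
  have hco : ∀ Φ : suppSub (𝔸 := 𝔸) S, (1 : ℝ) * ∑ z ∈ S, M z * fnorm τ ((Φ : Site d → 𝔸) z) ^ 2 ≤
      formE τ S Φ (deltaPrimeADom L (1 : Site d → Fin d → 𝔸ˣ) η τ hτp m a Λ S Φ) := by
    intro Φ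
    rw [one_mul]
    refine sum_mass_le_formE_deltaPrimeADom_one_cubeMember τ hτp hτt hτs hη0 ha i hΩ hρc hm (fun j hj y' hy' z hz => ?_) Φ
    rw [hMval j hj z (hz ▸ hy')]
    refine le_min ?_ ?_
    · exact mul_le_mul_of_nonneg_right hm₈8 (by positivity)
    · -- `m₈(ηLʲ)⁻² ≤ a_lo(ηLʲ)⁻² ≤ a_j(Lᵈ)^{−j}`
      have h := hlo j hj
      have hLd : 0 < ((L : ℝ) ^ d) ^ j := by positivity
      have key : m₈ * ((η * (L : ℝ) ^ j) ^ 2)⁻¹ * ((L : ℝ) ^ d) ^ j ≤ a j :=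
        calc m₈ * ((η * (L : ℝ) ^ j) ^ 2)⁻¹ * ((L : ℝ) ^ d) ^ j ≤ a_lo * ((η * (L : ℝ) ^ j) ^ 2)⁻¹ * ((L : ℝ) ^ d) ^ j := by gcongr
          _ = a_lo * ((L : ℝ) ^ d) ^ j * ((η * (L : ℝ) ^ j) ^ 2)⁻¹ := by ring
          _ ≤ a j := h
      calc m₈ * ((η * (L : ℝ) ^ j) ^ 2)⁻¹ = (m₈ * ((η * (L : ℝ) ^ j) ^ 2)⁻¹ * ((L : ℝ) ^ d) ^ j) * (((L : ℝ) ^ d) ^ j)⁻¹ := by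
            rw [mul_assoc (m₈ * _), mul_inv_cancel₀ hLd.ne', mul_one]
        _ ≤ a j * (((L : ℝ) ^ d) ^ j)⁻¹ := mul_le_mul_of_nonneg_right key (by positivity)
        _ = a j * (((L : ℝ) ^ d)⁻¹) ^ j := by rw [inv_pow]
  -- the two scaling slots with `B = 1∕m₈`, `A = a_hi∕m₈`
  have hB : ∀ z ∈ S, (η⁻¹) ^ 2 * (((L : ℝ) ^ m)⁻¹) ^ 2 ≤ m₈⁻¹ * M z := by
    intro z hz
    obtain ⟨j, hj, hzj⟩ := hcov z hz
    rw [hMval j hj z hzj]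
    have hjm : j ≤ m := Nat.lt_succ_iff.1 (Finset.mem_range.1 hj)
    have hLj : (L : ℝ) ^ j ≤ (L : ℝ) ^ m := pow_le_pow_right₀ (by exact_mod_cast hL1) hjm
    have hLj0 : 0 < (L : ℝ) ^ j := by positivity
    rw [← mul_assoc, inv_mul_cancel₀ hm₈0.ne', one_mul, mul_pow, mul_inv, inv_pow, inv_pow]
    gcongr
  have hA : ∀ z ∈ S, ∑ j ∈ Finset.range (m + 1), (if blockMapIter L j z ∈ Λ j then a j * (((L : ℝ) ^ d)⁻¹) ^ j else 0) ≤ a_hi * m₈⁻¹ * M z := by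
    intro z hz
    obtain ⟨j, hj, hzj⟩ := hcov z hz
    rw [sum_ite_eq_of_fullBlockGeometry hG hj hzj, hMval j hj z hzj]
    have h := hhi j hj
    have hLd : 0 < ((L : ℝ) ^ d) ^ j := by positivity
    rw [inv_pow, show a_hi * m₈⁻¹ * (m₈ * ((η * (L : ℝ) ^ j) ^ 2)⁻¹) = a_hi * ((η * (L : ℝ) ^ j) ^ 2)⁻¹ by field_simp]
    rw [← div_eq_mul_inv (a j), div_le_iff₀ hLd]
    calc a j ≤ a_hi * ((L : ℝ) ^ d) ^ j * ((η * (L : ℝ) ^ j) ^ 2)⁻¹ := h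
      _ = a_hi * ((η * (L : ℝ) ^ j) ^ 2)⁻¹ * ((L : ℝ) ^ d) ^ j := by ring
  -- the window with `θ = 1∕2`, `c₀ = 1`
  have hκ' : κ * (6 * d * m₈⁻¹ + 15 * (a_hi * m₈⁻¹)) ≤ 1 / 2 * 1 := by
    have h1 : κ * (6 * d * m₈⁻¹ + 15 * (a_hi * m₈⁻¹)) = (κ * (12 * d + 30 * a_hi)) / (2 * m₈) := by
      field_simp
      ring
    rw [h1, mul_one, div_le_iff₀ (by positivity), show (1 : ℝ) / 2 * (2 * m₈) = m₈ by ring]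
    exact hκ
  -- positivity of the mass at `x`, `y`
  have hMpos : ∀ z ∈ S, 0 < M z := fun z hz => by
    obtain ⟨j, hj, hzj⟩ := hcov z hz
    rw [hMval j hj z hzj]; positivity
  have hT : ∀ j', j' < m → ∀ z y' : Site d, bgT L (1 : Site d → Fin d → 𝔸ˣ) j' z y' ∈ unitaryUnits 𝔸 := fun j' _ z y' => by
    rw [bgT_one]; exact (unitaryUnits 𝔸).one_mem
  have hmain := fnorm_GpZd_single_le_exp_coarse L (1 : Site d → Fin d → 𝔸ˣ) η τ hτp m a Λ S hd i.hη.ne' hL1 hτt hτs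
    (fun _ _ => (unitaryUnits 𝔸).one_mem) hT ha one_pos (by norm_num : (0 : ℝ) ≤ 1 / 2) (by norm_num : (1 : ℝ) / 2 < 1) hM0 hco hκ0 hκ1 hκ' hB hA hy w
    (hMpos x hx) (hMpos y hy)
  refine hmain.trans ?_
  -- `√(M_xM_y) ≥ m₈(ηLᵐ)⁻²`
  obtain ⟨jx, hjx, hxj⟩ := hcov x hx
  obtain ⟨jy, hjy, hyj⟩ := hcov y hy
  have hfloor : ∀ {j : ℕ}, j ∈ Finset.range (m + 1) → m₈ * ((η * (L : ℝ) ^ m) ^ 2)⁻¹ ≤ m₈ * ((η * (L : ℝ) ^ j) ^ 2)⁻¹ := by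
    intro j hj
    have hjm : j ≤ m := Nat.lt_succ_iff.1 (Finset.mem_range.1 hj)
    have hLj : (L : ℝ) ^ j ≤ (L : ℝ) ^ m := pow_le_pow_right₀ (by exact_mod_cast hL1) hjm
    have hLj0 : 0 < η * (L : ℝ) ^ j := by positivity
    gcongr
  set μ₀ : ℝ := m₈ * ((η * (L : ℝ) ^ m) ^ 2)⁻¹ with hμ₀
  have hμ₀pos : 0 < μ₀ := by positivity
  have hMx : μ₀ ≤ M x := by rw [hMval jx hjx x hxj]; exact hfloor hjx
  have hMy : μ₀ ≤ M y := by rw [hMval jy hjy y hyj]; exact hfloor hjy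
  have hsqrt : μ₀ ≤ Real.sqrt (M x * M y) := by
    rw [Real.le_sqrt hμ₀pos.le (mul_pos (hMpos x hx) (hMpos y hy)).le, sq]
    exact mul_le_mul hMx hMy hμ₀pos.le (hMpos x hx).le
  have hE := Real.exp_pos (-(κ * (((L : ℝ) ^ m)⁻¹ * ((linfDist x y : ℕ) : ℝ))))
  have hw0 := fnorm_nonneg τ w
  have hden : (1 : ℝ) / ((1 - 1 / 2) * 1 * Real.sqrt (M x * M y)) ≤ 1 / ((1 - 1 / 2) * 1 * μ₀) := by
    apply one_div_le_one_div_of_le (by positivity)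
    exact mul_le_mul_of_nonneg_left hsqrt (by norm_num)
  have hμ₀inv : (1 : ℝ) / ((1 - 1 / 2) * 1 * μ₀) = 2 / m₈ * (η * (L : ℝ) ^ m) ^ 2 := by
    rw [hμ₀]
    have hpow : (0 : ℝ) < (η * (L : ℝ) ^ m) ^ 2 := by positivity
    field_simp
    ring
  calc Real.exp (-(κ * (((L : ℝ) ^ m)⁻¹ * ((linfDist x y : ℕ) : ℝ)))) / ((1 - 1 / 2) * 1 * Real.sqrt (M x * M y)) * fnorm τ w
      = (1 / ((1 - 1 / 2) * 1 * Real.sqrt (M x * M y))) * Real.exp (-(κ * (((L : ℝ) ^ m)⁻¹ * ((linfDist x y : ℕ) : ℝ)))) * fnorm τ w := by ring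
    _ ≤ (1 / ((1 - 1 / 2) * 1 * μ₀)) * Real.exp (-(κ * (((L : ℝ) ^ m)⁻¹ * ((linfDist x y : ℕ) : ℝ)))) * fnorm τ w := by gcongr
    _ = 2 / min 8 a_lo * (i.η * (L : ℝ) ^ m) ^ 2 * Real.exp (-(κ * (((L : ℝ) ^ m)⁻¹ * ((linfDist x y : ℕ) : ℝ)))) * fnorm τ w := by
        rw [hμ₀inv]

end Flat

/-! ## §3  A6: print's own weights `a_j = (Lᵈ)ʲ(ηLʲ)⁻²` — an explicit rate `1∕(12d + 30)` -/

section PrintWeights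

variable (L : ℕ) (τ : 𝔸 →ₗ[ℂ] ℂ) [FiniteDimensional ℝ 𝔸] (hτp : ∀ a : 𝔸, a ≠ 0 → 0 < (τ (star a * a)).re)

/-- ★★ **NON-VACUITY WITH PRINT'S WEIGHTS** (`a_j := (Lᵈ)ʲ·((ηLʲ)²)⁻¹`, i.e. `a = 1` in (3.24)'s `a_j(Lʲη)^{d−2}` after the volume weights): at every cube member,
for all `x, y ∈ □₀`, `|(G′(1)δ_y w)(x)|_τ ≤ 2·(ηLᵐ)²·e^{−(12d+30)⁻¹·L^{−m}|x−y|_∞}·|w|_τ` — every symbol on the right is explicit.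
[cite: Balaban1985BackgroundPropagators, Thm 3.1 p.397, (3.42) p.397, (3.24) p.394; Balaban1984PropagatorsII, (2.22) p.226; Balaban1985RegularSpaces, (1.131) p.99] -/
theorem fnorm_GpZd_one_single_le_exp_cubeMember_printWeights [Nontrivial 𝔸] (hd : 0 < d) (hL : 2 ≤ L) (hτt : ∀ a b : 𝔸, τ (a * b) = τ (b * a))
    (hτs : ∀ a : 𝔸, τ (star a) = starRingEnd ℂ (τ a)) (i : ZdIdx d L) {ac : Site d} {Mc ρc : ℕ} (hΩ : i.Ω = cubeFam false L ac Mc ρc i.k)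
    (hρc : L ≤ ρc) {m : ℕ} (hm : m ≤ i.k)
    {x y : Site d} (hx : x ∈ (cubeMember_Ω0_finite i hΩ).toFinset) (hy : y ∈ (cubeMember_Ω0_finite i hΩ).toFinset) (w : 𝔸) :
    fnorm τ ((GpZd L (1 : Site d → Fin d → 𝔸ˣ) i.η τ hτp m (fun j => ((L : ℝ) ^ d) ^ j * ((i.η * (L : ℝ) ^ j) ^ 2)⁻¹)
        (fun j => (cubeLamS_finite L ac Mc ρc i.k m j).toFinset)
        (cubeMember_Ω0_finite i hΩ).toFinset hd i.hη.ne' hτt hτs (fun _ _ => (unitaryUnits 𝔸).one_mem)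
        (fun j => by have := i.hη; positivity)
        (restrictSite (cubeMember_Ω0_finite i hΩ).toFinset (single y w)) : Site d → 𝔸) x) ≤
      2 * (i.η * (L : ℝ) ^ m) ^ 2 * Real.exp (-((12 * (d : ℝ) + 30)⁻¹ * (((L : ℝ) ^ m)⁻¹ * ((linfDist x y : ℕ) : ℝ)))) * fnorm τ w := by
  have hd0 : (0 : ℝ) < 12 * (d : ℝ) + 30 := by positivity
  have h := fnorm_GpZd_one_single_le_exp_cubeMember L τ hτp hd hL hτt hτs i hΩ hρc hm
    (a := fun j => ((L : ℝ) ^ d) ^ j * ((i.η * (L : ℝ) ^ j) ^ 2)⁻¹) (fun j => by have := i.hη; positivity) (a_lo := 1) (a_hi := 1) one_pos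
    (fun j _ => by rw [one_mul]) (fun j _ => by rw [one_mul]) (κ := (12 * (d : ℝ) + 30)⁻¹) (by positivity)
    (by rw [inv_le_one_iff₀]; right; linarith) (by rw [mul_one, inv_mul_cancel₀ hd0.ne']; exact le_min (by norm_num) le_rfl) hx hy w
  have hmin : min (8 : ℝ) 1 = 1 := min_eq_right (by norm_num)
  rw [hmin, div_one] at h
  exact h

end PrintWeights

end Literature.MathematicalPhysics.QuantumFieldTheory.Balaban1983to89.B9Thm31GpAgmonDecayFlatCubeZd

end
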